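import Literature.NumberTheory.LFunctions.WeilGroundEnergyProofs
import Literature.NumberTheory.LFunctions.WeilExplicitArchTermProofs
import HarnessLib

/-!
# The Markov (pole-removed) part of Weil's quadratic functional

Sibling of `Literature/NumberTheory/LFunctions/WeilExplicit.lean` (same normalisation: additive
variable `t = log x`, `ĝ(s) = weilMellin g s = ∫ g(t) e^{(s-1/2)t} dt`, `g̃(t) = conj g(-t)`,
`Q(g) = weilQuadratic g = W(g ⋆ g̃)`, `W = weilPolarTerm − weilPrimeTerm + weilArchTerm`).

Requested by route `RiemannHypothesis/WeilGroundState` (support item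
`MarkovPartPositiveGroundState`; cards `weil-ground-state-perron-frobenius`, `weil-levy-generator`):
the decomposition of Weil's hermitian form on a window `[-a, a]` as

  `Re Q(g) = P(g) + 𝓔_a(g) − M_a ‖g‖₂²`,

where

* `P(g) = weilPoleForm g = 2 |∫ g(t) cosh(t/2) dt|² − 2 |∫ g(t) sinh(t/2) dt|²` is the **pole form**,
  the polar term `k̂(0) + k̂(1) = 2 Re(ĝ(0) conj ĝ(1))` of `k = g ⋆ g̃` (Yoshida 1992, (6.2);
  `ĝ(1) = ∫ g cosh(t/2) + ∫ g sinh(t/2)`, `ĝ(0) = ∫ g cosh(t/2) − ∫ g sinh(t/2)`), a hermitian form of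
  signature `(1, 1)` which is diagonal with respect to parity;
* `𝓔_a(g) = weilDirichletEnergy a g
     = Σ_{log n < 2a} Λ(n) n^{-1/2} ∫ |g(x + log n) − g(x)|² dx
       + ∫₀^∞ e^{t/2}/(2 sinh t) · (∫ |g(x + t) − g(x)|² dx) dt ≥ 0`
  is a **pure-jump Dirichlet (increment) form**: jump rates `Λ(n) n^{-1/2} ≥ 0` at the lengths
  `log n`, archimedean jump density `e^{t/2}/(2 sinh t) = e^{-t/2}/(1 − e^{-2t}) > 0` at every length
  `t > 0`; it is *Markovian* in the sense of Beurling–Deny / Fukushima (every `1`-Lipschitz map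
  `Φ` of the target operates: `𝓔_a(Φ ∘ g) ≤ 𝓔_a(g)`, `weilDirichletEnergy_comp_le`) and invariant
  under `g ↦ g̃` and `g ↦ g(−·)`;
* `M_a = weilMarkovConstant a = 2 Σ_{log n < 2a} Λ(n) n^{-1/2} + 2 ∫₀^∞ (e^{t/2} − 1)/(2 sinh t) dt
     + log 4π + γ` is a constant (the **killing rate**, of either sign);
* `weilMarkovQuadratic g := Re Q(g) − P(g)` is the **Markov (pole-removed) part** of the form.

The identity (`weilMarkovQuadratic_eq_weilDirichletEnergy_sub`, for smooth `g` supported in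
`[-a, a]`) is Bombieri's explicit formula (Bombieri 2000, Thm 2, archimedean term in the form
`−(log 4π + γ) f(1) − ∫₁^∞ (f(x) + f*(x) − (2/x) f(1)) x dx/(x² − 1)`, i.e. `weilArchTermBombieri`,
equal to the digamma form by `weilArchTermBombieri_eq_weilArchTerm_holds`) combined with the
elementary identity for the kernel `k = g ⋆ g̃`

  `k(t) + k(−t) = 2 Re k(t) = 2 ‖g‖₂² − ∫ |g(x + t) − g(x)|² dx`     (`weilConv_weilReflect_add_neg`)

inserted in the prime term `Σ Λ(n) n^{-1/2}(k(log n) + k(−log n))` and in Bombieri's integrand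
`(e^{t/2}(k(t) + k(−t)) − 2k(0))/(2 sinh t)`, `k(0) = ‖g‖₂²`. Reading the local terms of the
explicit formula as generators of jump (Lévy / Riesz-potential) forms goes back to Haran (1990).

## Contents (everything PROVED; no named facts, no new hypotheses)

* definitions `weilPoleForm`, `weilMarkovQuadratic`, `weilIncrement`, `weilArchDensity`,
  `weilPrimeIndex`, `weilDirichletEnergy`, `weilMarkovConstant`;
* `weilPolarTerm_weilConv_weilReflect_re`: `Re (k̂(0) + k̂(1)) = weilPoleForm g`;
* `weilConv_weilReflect_add_neg`: `k(t) + k(−t) = 2‖g‖₂² − weilIncrement g t`;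
* `weilPrimeTerm_weilConv_weilReflect`, `weilArchTermBombieri_weilConv_weilReflect`: the prime and
  archimedean terms of `Q(g)` through increments;
* `weilMarkovQuadratic_eq_weilDirichletEnergy_sub`: **the Markov decomposition**
  `weilMarkovQuadratic g = weilDirichletEnergy a g − weilMarkovConstant a · ‖g‖₂²`
  for `IsWeilTest g`, `tsupport g ⊆ [-a, a]`;
* `weilDirichletEnergy_nonneg`, `weilDirichletEnergy_weilReflect`, `weilDirichletEnergy_comp_neg`,
  `weilIncrement_comp_le`, `weilDirichletEnergy_comp_le` (Markov property), and the finiteness of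
  the energy of test functions (`integrableOn_weilArchDensity_mul_weilIncrement`).

## References

* E. Bombieri, *Remarks on Weil's quadratic functional in the theory of prime numbers I*, Rend.
  Mat. Acc. Lincei (9) 11 (2000), 183–233, Theorem 2 (p. 193).
* H. Yoshida, *On Hermitian forms attached to zeta functions*, Adv. Stud. Pure Math. 21 (1992),
  281–325, §6 (6.2).
* S. Haran, *Riesz potentials and explicit sums in arithmetic*, Invent. Math. 101 (1990), 697–703.
* Z.-Q. Chen, M. Fukushima, *Symmetric Markov Processes, Time Change, and Boundary Theory*,
  LMS Monographs 35, Princeton UP (2012), §1.1, Definitions 1.1.1–1.1.2 and Theorem 1.1.3(e)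
  (normal contractions operate on a Dirichlet form).
-/

noncomputable section

open Complex Filter Set MeasureTheory
open scoped Real Topology ComplexConjugate ArithmeticFunction.vonMangoldt

namespace Literature.NumberTheory.LFunctions

variable {g : ℝ → ℂ}

/-! ## Definitions -/

/-- The **pole form** `P(g) = 2 |∫ g(t) cosh(t/2) dt|² − 2 |∫ g(t) sinh(t/2) dt|²`: the polar term
`k̂(0) + k̂(1) = 2 Re(ĝ(0) conj ĝ(1))` of `k = g ⋆ g̃` written through
`ĝ(1) = ∫ g cosh(t/2) + ∫ g sinh(t/2)`, `ĝ(0) = ∫ g cosh(t/2) − ∫ g sinh(t/2)`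
(`weilPolarTerm_weilConv_weilReflect_re`); Yoshida's (6.2) (`= 2ε |∫ φ e^{x/2}|²` for `φ̌ = εφ`) in
parity-free form: a hermitian form of signature `(1,1)`, diagonal with respect to parity.
[cite: Yoshida1992, §6 eq. (6.2)] -/
def weilPoleForm (g : ℝ → ℂ) : ℝ :=
  2 * ‖∫ t : ℝ, g t * (Real.cosh (t / 2) : ℂ)‖ ^ 2 - 2 * ‖∫ t : ℝ, g t * (Real.sinh (t / 2) : ℂ)‖ ^ 2

/-- The **Markov (pole-removed) part** of Weil's quadratic functional,
`Q₀(g) := Re Q(g) − P(g) = Re W(g ⋆ g̃) − (2|∫ g cosh(t/2)|² − 2|∫ g sinh(t/2)|²)`, i.e. minus the prime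
term plus the archimedean term of the explicit formula (Bombieri 2000, Thm 2) evaluated at `g ⋆ g̃`.
On a window `[-a, a]` it is a pure-jump Dirichlet form minus a constant multiple of `‖g‖₂²`
(`weilMarkovQuadratic_eq_weilDirichletEnergy_sub`). [cite: Bombieri2000Weil, Thm 2 (p. 193)] -/
def weilMarkovQuadratic (g : ℝ → ℂ) : ℝ :=
  (weilQuadratic g).re - weilPoleForm g

/-- The **increment form** `D_t(g) = ∫ |g(x + t) − g(x)|² dx` (squared `L²`-distance between `g`
and its translate; `= 2‖g‖₂² − (k(t) + k(−t))` for `k = g ⋆ g̃`, `weilConv_weilReflect_add_neg`).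
A real Bochner integral (junk value `0` when `x ↦ |g(x+t) − g(x)|²` is not integrable). [folklore] -/
def weilIncrement (g : ℝ → ℂ) (t : ℝ) : ℝ :=
  ∫ x : ℝ, ‖g (x + t) - g x‖ ^ 2

/-- The **archimedean jump density** `e^{t/2}/(2 sinh t) = e^{-t/2}/(1 − e^{-2t})` (`t > 0`) of
Bombieri's integrand `x dx/(x² − 1)`, `x = e^t` (Bombieri 2000, Thm 2); positive on `(0, ∞)`,
`~ 1/(2t)` at `0⁺` and `~ e^{-t/2}` at infinity. [cite: Bombieri2000Weil, Thm 2 (p. 193)] -/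
def weilArchDensity (t : ℝ) : ℝ :=
  Real.exp (t / 2) / (2 * Real.sinh t)

/-- The prime powers that enter the window `[-a, a]`: `{n : log n < 2a}` as a `Finset`
(`mem_weilPrimeIndex`; the kernel `g ⋆ g̃` is supported in `[-2a, 2a]`). [folklore] -/
def weilPrimeIndex (a : ℝ) : Finset ℕ :=
  (Finset.range (⌊Real.exp (2 * a)⌋₊ + 1)).filter fun n ↦ Real.log n < 2 * a

/-- The **pure-jump Dirichlet (energy) form of the window `[-a, a]`**:
`𝓔_a(g) = Σ_{log n < 2a} Λ(n) n^{-1/2} D_{log n}(g) + ∫₀^∞ e^{t/2}/(2 sinh t) D_t(g) dt`,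
`D_t(g) = ∫ |g(x+t) − g(x)|² dx`: non-negative jump rates `Λ(n) n^{-1/2}` at the lengths `log n` and
the positive archimedean density at every length `t > 0`. It is non-negative
(`weilDirichletEnergy_nonneg`), Markovian (`weilDirichletEnergy_comp_le`; Chen–Fukushima
Def. 1.1.2 / Thm. 1.1.3(e)) and reflection invariant (`weilDirichletEnergy_weilReflect`).
[cite: Bombieri2000Weil, Thm 2 (p. 193)] [cite: ChenFukushima2012, §1.1 Def. 1.1.2 (Markovian form)] -/
def weilDirichletEnergy (a : ℝ) (g : ℝ → ℂ) : ℝ :=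
  (∑ n ∈ weilPrimeIndex a, (Λ n : ℝ) / Real.sqrt n * weilIncrement g (Real.log n)) +
    ∫ t in Ioi (0 : ℝ), weilArchDensity t * weilIncrement g t

/-- The **killing constant of the window `[-a, a]`**:
`M_a = 2 Σ_{log n < 2a} Λ(n) n^{-1/2} + 2 ∫₀^∞ (e^{t/2} − 1)/(2 sinh t) dt + log 4π + γ`
(the coefficient of `‖g‖₂² = k(0)` collected from the prime term, from Bombieri's integrand
`(e^{t/2}(k(t)+k(−t)) − 2k(0))/(2 sinh t)` and from `−(log 4π + γ) k(0)`; the integral converges,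
`integrableOn_weilKillingDensity`). [cite: Bombieri2000Weil, Thm 2 (p. 193)] -/
def weilMarkovConstant (a : ℝ) : ℝ :=
  2 * (∑ n ∈ weilPrimeIndex a, (Λ n : ℝ) / Real.sqrt n) +
    2 * (∫ t in Ioi (0 : ℝ), (Real.exp (t / 2) - 1) / (2 * Real.sinh t)) +
    (Real.log (4 * π) + Real.eulerMascheroniConstant)

/-! ## Unfolding lemmas -/

/-- `weilMarkovQuadratic g` in the inline shape used by route statements:
`Re Q(g) − 2|∫ g cosh(t/2)|² + 2|∫ g sinh(t/2)|²`. [folklore] -/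
theorem weilMarkovQuadratic_eq (g : ℝ → ℂ) :
    weilMarkovQuadratic g =
      (weilQuadratic g).re - 2 * ‖∫ t : ℝ, g t * (Real.cosh (t / 2) : ℂ)‖ ^ 2 +
        2 * ‖∫ t : ℝ, g t * (Real.sinh (t / 2) : ℂ)‖ ^ 2 := by
  unfold weilMarkovQuadratic weilPoleForm
  ring

/-- `Re Q(g) = P(g) + Q₀(g)`. [folklore] -/
theorem weilQuadratic_re_eq_weilPoleForm_add (g : ℝ → ℂ) :
    (weilQuadratic g).re = weilPoleForm g + weilMarkovQuadratic g := by
  unfold weilMarkovQuadratic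
  ring

/-- Membership in the prime index set: `n ∈ weilPrimeIndex a ↔ log n < 2a`. [folklore] -/
theorem mem_weilPrimeIndex {a : ℝ} {n : ℕ} : n ∈ weilPrimeIndex a ↔ Real.log n < 2 * a := by
  unfold weilPrimeIndex
  simp only [Finset.mem_filter, Finset.mem_range, and_iff_right_iff_imp]
  intro h
  rcases Nat.eq_zero_or_pos n with rfl | hn
  · exact Nat.succ_pos _
  · have hn' : (0 : ℝ) < n := by exact_mod_cast hn
    have hlt : (n : ℝ) < Real.exp (2 * a) := (Real.log_lt_iff_lt_exp hn').1 h
    have hle : n ≤ ⌊Real.exp (2 * a)⌋₊ := Nat.le_floor hlt.le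
    omega

/-- The archimedean density is positive on `(0, ∞)`. [folklore] -/
theorem weilArchDensity_pos {t : ℝ} (ht : 0 < t) : 0 < weilArchDensity t :=
  div_pos (Real.exp_pos _) (mul_pos two_pos (Real.sinh_pos_iff.2 ht))

/-- The increment form is non-negative. [folklore] -/
theorem weilIncrement_nonneg (g : ℝ → ℂ) (t : ℝ) : 0 ≤ weilIncrement g t :=
  integral_nonneg fun _ ↦ by positivity

/-- **`𝓔_a ≥ 0`**: the Dirichlet energy is non-negative (non-negative rates and densities against
non-negative increments). [folklore] -/
theorem weilDirichletEnergy_nonneg (a : ℝ) (g : ℝ → ℂ) : 0 ≤ weilDirichletEnergy a g := by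
  refine add_nonneg (Finset.sum_nonneg fun n _ ↦ mul_nonneg
    (div_nonneg ArithmeticFunction.vonMangoldt_nonneg (Real.sqrt_nonneg _))
    (weilIncrement_nonneg g _)) ?_
  exact setIntegral_nonneg measurableSet_Ioi fun t ht ↦
    mul_nonneg (weilArchDensity_pos ht).le (weilIncrement_nonneg g t)

/-! ## The increment form: substitutions, symmetries, contractions -/

/-- `D_t(g) = ∫ |g(u) − g(u − t)|² du` (substitute `x = u − t`). [folklore] -/
theorem weilIncrement_eq_integral_sub (g : ℝ → ℂ) (t : ℝ) :
    weilIncrement g t = ∫ u : ℝ, ‖g u - g (u - t)‖ ^ 2 := by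
  rw [weilIncrement, ← integral_add_right_eq_self (fun u : ℝ ↦ ‖g u - g (u - t)‖ ^ 2) t]
  simp only [add_sub_cancel_right]

/-- The increment form is even in `t`: `D_{-t}(g) = D_t(g)`. [folklore] -/
theorem weilIncrement_neg (g : ℝ → ℂ) (t : ℝ) : weilIncrement g (-t) = weilIncrement g t := by
  rw [weilIncrement_eq_integral_sub g t, weilIncrement]
  congr 1 with x
  rw [← sub_eq_add_neg, norm_sub_rev]

/-- `D_t(g(−·)) = D_t(g)`. [folklore] -/
theorem weilIncrement_comp_neg (g : ℝ → ℂ) (t : ℝ) :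
    weilIncrement (fun x ↦ g (-x)) t = weilIncrement g t := by
  calc weilIncrement (fun x ↦ g (-x)) t
      = ∫ x : ℝ, ‖g (-x - t) - g (-x)‖ ^ 2 := by
        rw [weilIncrement]
        congr 1 with x
        rw [neg_add']
    _ = ∫ x : ℝ, ‖g (x - t) - g x‖ ^ 2 :=
        integral_neg_eq_self (fun x : ℝ ↦ ‖g (x - t) - g x‖ ^ 2) volume
    _ = weilIncrement g t := by
        rw [weilIncrement_eq_integral_sub]
        congr 1 with x
        rw [norm_sub_rev]

/-- **Reflection invariance of the increments**: `D_t(g̃) = D_t(g)` for `g̃(x) = conj g(−x)`. [folklore] -/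
theorem weilIncrement_weilReflect (g : ℝ → ℂ) (t : ℝ) :
    weilIncrement (weilReflect g) t = weilIncrement g t := by
  have h : weilIncrement (weilReflect g) t = weilIncrement (fun x ↦ g (-x)) t := by
    unfold weilIncrement weilReflect
    congr 1 with x
    rw [← map_sub, Complex.norm_conj]
  rw [h, weilIncrement_comp_neg]

/-- **The Dirichlet energy is reflection invariant**: `𝓔_a(g̃) = 𝓔_a(g)`. [folklore] -/
theorem weilDirichletEnergy_weilReflect (a : ℝ) (g : ℝ → ℂ) :
    weilDirichletEnergy a (weilReflect g) = weilDirichletEnergy a g := by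
  simp only [weilDirichletEnergy, weilIncrement_weilReflect]

/-- `𝓔_a(g(−·)) = 𝓔_a(g)`. [folklore] -/
theorem weilDirichletEnergy_comp_neg (a : ℝ) (g : ℝ → ℂ) :
    weilDirichletEnergy a (fun x ↦ g (-x)) = weilDirichletEnergy a g := by
  simp only [weilDirichletEnergy, weilIncrement_comp_neg]

/-- For `g ∈ L²` the increment integrand `x ↦ |g(x + t) − g(x)|²` is integrable. [folklore] -/
theorem integrable_weilIncrement_integrand (hg : MemLp g 2 volume) (t : ℝ) :
    Integrable fun x : ℝ ↦ ‖g (x + t) - g x‖ ^ 2 := by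
  have htr : MemLp (fun x : ℝ ↦ g (x + t)) 2 volume :=
    hg.comp_measurePreserving (measurePreserving_add_right volume t)
  have hsub : MemLp (fun x : ℝ ↦ g (x + t) - g x) 2 volume := htr.sub hg
  exact (memLp_two_iff_integrable_sq_norm hsub.1).1 hsub

/-- A test function is in `L²`. [folklore] -/
theorem IsWeilTest.memLp_two (hg : IsWeilTest g) : MemLp g 2 volume :=
  hg.1.continuous.memLp_of_hasCompactSupport hg.2

/-- **Contractions decrease increments.** If `Φ : ℂ → ℂ` is `1`-Lipschitz and the increment
integrand of `g` at `t` is integrable, then `D_t(Φ ∘ g) ≤ D_t(g)`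
(`|Φ(g(x+t)) − Φ(g(x))| ≤ |g(x+t) − g(x)|` pointwise). [folklore] -/
theorem weilIncrement_comp_le {Φ : ℂ → ℂ} (hΦ : LipschitzWith 1 Φ) {t : ℝ}
    (hint : Integrable fun x : ℝ ↦ ‖g (x + t) - g x‖ ^ 2) :
    weilIncrement (Φ ∘ g) t ≤ weilIncrement g t := by
  unfold weilIncrement
  refine integral_mono_of_nonneg (Eventually.of_forall fun x ↦ by positivity) hint
    (Eventually.of_forall fun x ↦ ?_)
  have h : ‖Φ (g (x + t)) - Φ (g x)‖ ≤ ‖g (x + t) - g x‖ := by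
    have := hΦ.dist_le_mul (g (x + t)) (g x)
    simpa [dist_eq_norm] using this
  simpa only [Function.comp_apply] using pow_le_pow_left₀ (norm_nonneg _) h 2

/-- **The Markov property of `𝓔_a`** (normal contractions operate; Chen–Fukushima Def. 1.1.2,
Thm. 1.1.3(e)): for a `1`-Lipschitz `Φ : ℂ → ℂ` and `g` of finite energy (integrable increment
integrands and integrable archimedean part — e.g. a test function,
`integrableOn_weilArchDensity_mul_weilIncrement`), `𝓔_a(Φ ∘ g) ≤ 𝓔_a(g)`.
(`Φ(0) = 0` is not needed for the jump part; it only matters for the killing term.)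
[cite: ChenFukushima2012, §1.1 Def. 1.1.2 and Thm. 1.1.3(e)] -/
theorem weilDirichletEnergy_comp_le {Φ : ℂ → ℂ} (hΦ : LipschitzWith 1 Φ) (a : ℝ)
    (hint : ∀ t : ℝ, Integrable fun x : ℝ ↦ ‖g (x + t) - g x‖ ^ 2)
    (hfin : IntegrableOn (fun t : ℝ ↦ weilArchDensity t * weilIncrement g t) (Ioi 0)) :
    weilDirichletEnergy a (Φ ∘ g) ≤ weilDirichletEnergy a g := by
  refine add_le_add (Finset.sum_le_sum fun n _ ↦ mul_le_mul_of_nonneg_left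
    (weilIncrement_comp_le hΦ (hint _))
    (div_nonneg ArithmeticFunction.vonMangoldt_nonneg (Real.sqrt_nonneg _))) ?_
  refine integral_mono_of_nonneg ?_ hfin ?_
  · exact (ae_restrict_iff' measurableSet_Ioi).2 (Eventually.of_forall fun t ht ↦
      mul_nonneg (weilArchDensity_pos ht).le (weilIncrement_nonneg _ t))
  · exact (ae_restrict_iff' measurableSet_Ioi).2 (Eventually.of_forall fun t ht ↦
      mul_le_mul_of_nonneg_left (weilIncrement_comp_le hΦ (hint t)) (weilArchDensity_pos ht).le)

/-- Real normal contractions (`|Φ x − Φ y| ≤ |x − y|`) acting on real-valued `g`: the case of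
Chen–Fukushima Def. 1.1.1, as a special case of `weilDirichletEnergy_comp_le`.
[cite: ChenFukushima2012, §1.1 Def. 1.1.1–1.1.2] -/
theorem weilDirichletEnergy_ofReal_comp_le {Φ : ℝ → ℝ} (hΦ : LipschitzWith 1 Φ) (a : ℝ)
    {f : ℝ → ℝ} (hint : ∀ t : ℝ, Integrable fun x : ℝ ↦ ‖((f (x + t) : ℝ) : ℂ) - (f x : ℂ)‖ ^ 2)
    (hfin : IntegrableOn
      (fun t : ℝ ↦ weilArchDensity t * weilIncrement (fun x ↦ (f x : ℂ)) t) (Ioi 0)) :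
    weilDirichletEnergy a (fun x ↦ ((Φ (f x) : ℝ) : ℂ)) ≤
      weilDirichletEnergy a (fun x ↦ ((f x : ℝ) : ℂ)) := by
  -- `Ψ(z) = Φ(Re z)` is a `1`-Lipschitz map of `ℂ` extending `Φ`
  set Ψ : ℂ → ℂ := fun z ↦ ((Φ z.re : ℝ) : ℂ) with hΨ
  have hΨL : LipschitzWith 1 Ψ := by
    refine LipschitzWith.of_dist_le_mul fun z w ↦ ?_
    rw [hΨ]
    simp only [NNReal.coe_one, one_mul, Complex.dist_eq, ← Complex.ofReal_sub, Complex.norm_real,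
      Real.norm_eq_abs]
    calc |Φ z.re - Φ w.re| ≤ |z.re - w.re| := by
          have := hΦ.dist_le_mul z.re w.re
          simpa [Real.dist_eq] using this
      _ = |(z - w).re| := by rw [Complex.sub_re]
      _ ≤ ‖z - w‖ := Complex.abs_re_le_norm _
  have hcomp : (fun x ↦ ((Φ (f x) : ℝ) : ℂ)) = Ψ ∘ fun x ↦ ((f x : ℝ) : ℂ) := by
    funext x
    simp [hΨ]
  rw [hcomp]
  exact weilDirichletEnergy_comp_le hΨL a hint hfin

/-! ## The polar term of `g ⋆ g̃` is the pole form -/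

/-- `ĝ(1) = ∫ g(x) cosh(x/2) dx + ∫ g(x) sinh(x/2) dx` (`e^{x/2} = cosh(x/2) + sinh(x/2)`). [folklore] -/
theorem weilMellin_one_eq_cosh_add_sinh (hg : IsWeilTest g) :
    weilMellin g 1 =
      (∫ x : ℝ, g x * (Real.cosh (x / 2) : ℂ)) + ∫ x : ℝ, g x * (Real.sinh (x / 2) : ℂ) := by
  unfold weilMellin
  rw [← integral_add (hg.integrable_mul (by fun_prop)) (hg.integrable_mul (by fun_prop))]
  congr 1 with x
  have : cexp ((1 - 1 / 2) * (x : ℂ)) = (Real.cosh (x / 2) : ℂ) + (Real.sinh (x / 2) : ℂ) := by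
    rw [← Complex.ofReal_add, Real.cosh_add_sinh, Complex.ofReal_exp]
    congr 1
    push_cast
    ring
  rw [this]
  ring

/-- `ĝ(0) = ∫ g(x) cosh(x/2) dx − ∫ g(x) sinh(x/2) dx` (`e^{-x/2} = cosh(x/2) − sinh(x/2)`). [folklore] -/
theorem weilMellin_zero_eq_cosh_sub_sinh (hg : IsWeilTest g) :
    weilMellin g 0 =
      (∫ x : ℝ, g x * (Real.cosh (x / 2) : ℂ)) - ∫ x : ℝ, g x * (Real.sinh (x / 2) : ℂ) := by
  unfold weilMellin
  rw [← integral_sub (hg.integrable_mul (by fun_prop)) (hg.integrable_mul (by fun_prop))]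
  congr 1 with x
  have : cexp ((0 - 1 / 2) * (x : ℂ)) = (Real.cosh (x / 2) : ℂ) - (Real.sinh (x / 2) : ℂ) := by
    rw [← Complex.ofReal_sub, Real.cosh_sub_sinh, Complex.ofReal_exp]
    congr 1
    push_cast
    ring
  rw [this]
  ring

/-- `2 Re(ĝ(0) conj ĝ(1)) = 2|c|² − 2|s|² = P(g)` with `c = ∫ g cosh(x/2)`, `s = ∫ g sinh(x/2)`
(Yoshida (6.2), parity-free). [cite: Yoshida1992, §6 eq. (6.2)] -/
theorem two_mul_re_weilMellin_zero_mul_conj_one (hg : IsWeilTest g) :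
    2 * (weilMellin g 0 * conj (weilMellin g 1)).re = weilPoleForm g := by
  rw [weilMellin_zero_eq_cosh_sub_sinh hg, weilMellin_one_eq_cosh_add_sinh hg, weilPoleForm,
    ← Complex.normSq_eq_norm_sq, ← Complex.normSq_eq_norm_sq, Complex.normSq_apply,
    Complex.normSq_apply]
  simp only [mul_re, sub_re, sub_im, map_add, add_re, add_im, conj_re, conj_im]
  ring

/-- **The polar term of `k = g ⋆ g̃` is the pole form**: `Re (k̂(0) + k̂(1)) = P(g)`
(`k̂(0) + k̂(1) = 2 Re(ĝ(0) conj ĝ(1))`, `weilPolarTerm_weilConv_weilReflect`; Yoshida (6.2)).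
[cite: Yoshida1992, §6 eq. (6.2)] -/
theorem weilPolarTerm_weilConv_weilReflect_re (hg : IsWeilTest g) :
    (weilPolarTerm (weilConv g (weilReflect g))).re = weilPoleForm g := by
  rw [weilPolarTerm_weilConv_weilReflect hg, Complex.ofReal_re,
    two_mul_re_weilMellin_zero_mul_conj_one hg]

/-- Hence `Q₀(g) = Re Q(g) − Re (k̂(0) + k̂(1)) = Re(−weilPrimeTerm k + weilArchTerm k)`,
`k = g ⋆ g̃`. [folklore] -/
theorem weilMarkovQuadratic_eq_re (hg : IsWeilTest g) :
    weilMarkovQuadratic g =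
      -(weilPrimeTerm (weilConv g (weilReflect g))).re +
        (weilArchTerm (weilConv g (weilReflect g))).re := by
  rw [weilMarkovQuadratic, ← weilPolarTerm_weilConv_weilReflect_re hg]
  simp only [weilQuadratic, weilFunctional, Complex.add_re, Complex.sub_re]
  ring

/-! ## The kernel `k = g ⋆ g̃` through increments -/

/-- `k(−t) = conj k(t)` for `k = g ⋆ g̃` (`conj_weilConv_weilReflect_neg`). [folklore] -/
theorem weilConv_weilReflect_neg (g : ℝ → ℂ) (t : ℝ) :
    weilConv g (weilReflect g) (-t) = conj (weilConv g (weilReflect g) t) := by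
  rw [← conj_weilConv_weilReflect_neg g t, Complex.conj_conj]

/-- `z conj w + conj z · w = |z|² + |w|² − |z − w|²` (polarisation). [folklore] -/
theorem mul_conj_add_conj_mul_eq (z w : ℂ) :
    z * conj w + conj z * w = ((‖z‖ ^ 2 + ‖w‖ ^ 2 - ‖z - w‖ ^ 2 : ℝ) : ℂ) := by
  have h1 : conj z * w = conj (z * conj w) := by rw [map_mul, Complex.conj_conj]
  rw [h1, Complex.add_conj, norm_sub_sq_complex]
  congr 1
  ring

/-- **The kernel through increments**: for a test function `g` and `k = g ⋆ g̃`,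
`k(t) + k(−t) = 2‖g‖₂² − ∫ |g(x + t) − g(x)|² dx` (`k(t) = ∫ g(u) conj g(u − t) du`,
`k(−t) = conj k(t)`, and `2 Re(g(u) conj g(u−t)) = |g(u)|² + |g(u−t)|² − |g(u) − g(u−t)|²`).
This identity turns the prime and archimedean terms of the explicit formula into jump forms. [folklore] -/
theorem weilConv_weilReflect_add_neg (hg : IsWeilTest g) (t : ℝ) :
    weilConv g (weilReflect g) t + weilConv g (weilReflect g) (-t) =
      ((2 * (∫ x : ℝ, ‖g x‖ ^ 2) - weilIncrement g t : ℝ) : ℂ) := by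
  have h2 : Integrable fun u : ℝ ↦ ‖g u‖ ^ 2 := hg.integrable_norm_sq
  have h2' : Integrable fun u : ℝ ↦ ‖g (u - t)‖ ^ 2 := h2.comp_sub_right t
  have h22 : Integrable fun u : ℝ ↦ ‖g u‖ ^ 2 + ‖g (u - t)‖ ^ 2 := h2.add h2'
  have hD : Integrable fun u : ℝ ↦ ‖g u - g (u - t)‖ ^ 2 := by
    have h := integrable_weilIncrement_integrand hg.memLp_two (-t)
    refine h.congr (Eventually.of_forall fun u ↦ ?_)
    simp only [← sub_eq_add_neg]
    rw [norm_sub_rev]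
  have hgc : Continuous g := hg.1.continuous
  have hI : Integrable fun u : ℝ ↦ g u * conj (g (u - t)) :=
    (hgc.mul (Complex.continuous_conj.comp (hgc.comp (continuous_sub_right t)))).integrable_of_hasCompactSupport
      hg.2.mul_right
  have hI' : Integrable fun u : ℝ ↦ conj (g u) * g (u - t) :=
    ((Complex.continuous_conj.comp hgc).mul (hgc.comp (continuous_sub_right t))).integrable_of_hasCompactSupport
      ((hg.2.comp_left (g := conj) (map_zero _)).mul_right)
  have hk : weilConv g (weilReflect g) t = ∫ u : ℝ, g u * conj (g (u - t)) := by
    rw [weilConv_apply]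
    congr 1 with u
    simp [weilReflect, neg_sub]
  have hk' : conj (weilConv g (weilReflect g) t) = ∫ u : ℝ, conj (g u) * g (u - t) := by
    rw [hk, ← integral_conj]
    congr 1 with u
    simp only [map_mul, Complex.conj_conj]
  rw [weilConv_weilReflect_neg, hk', hk, ← integral_add hI hI']
  simp_rw [mul_conj_add_conj_mul_eq]
  rw [integral_complex_ofReal, integral_sub h22 hD, integral_add h2 h2',
    integral_sub_right_eq_self (fun u : ℝ ↦ ‖g u‖ ^ 2) t, weilIncrement_eq_integral_sub]
  push_cast
  ring

/-! ## The prime term through increments -/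

/-- For `tsupport g ⊆ [-a, a]` the kernel `k = g ⋆ g̃` vanishes at `|t| ≥ 2a` (its support is
contained in the open interval `(-2a, 2a)`; Yoshida §2). [cite: Yoshida1992, §2] -/
theorem weilConv_weilReflect_eq_zero_of_le_abs (hg : IsWeilTest g) {a : ℝ}
    (hsupp : tsupport g ⊆ Icc (-a) a) {t : ℝ} (ht : 2 * a ≤ |t|) :
    weilConv g (weilReflect g) t = 0 := by
  have hk : IsWeilTest (weilConv g (weilReflect g)) := hg.weilConv hg.weilReflect
  have hks := support_subset_Ioo_of_tsupport_subset_Icc hk.1.continuous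
    (tsupport_weilConv_weilReflect_subset hg.2 hsupp)
  by_contra hne
  have hmem := hks (Function.mem_support.2 hne)
  have : |t| < 2 * a := abs_lt.2 ⟨hmem.1, hmem.2⟩
  linarith

/-- **The prime term through increments**: for a test function `g` supported in `[-a, a]`,
`Σₙ Λ(n) n^{-1/2} (k(log n) + k(−log n)) = Σ_{log n < 2a} Λ(n) n^{-1/2} (2‖g‖₂² − D_{log n}(g))`,
`k = g ⋆ g̃` (only `log n < 2a` contributes, `weilConv_weilReflect_eq_zero_of_le_abs`, and
`k(t) + k(−t) = 2‖g‖₂² − D_t(g)`). [cite: Bombieri2000Weil, Thm 2 (p. 193), prime term] -/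
theorem weilPrimeTerm_weilConv_weilReflect (hg : IsWeilTest g) {a : ℝ}
    (hsupp : tsupport g ⊆ Icc (-a) a) :
    weilPrimeTerm (weilConv g (weilReflect g)) =
      ((∑ n ∈ weilPrimeIndex a, (Λ n : ℝ) / Real.sqrt n *
        (2 * (∫ x : ℝ, ‖g x‖ ^ 2) - weilIncrement g (Real.log n)) : ℝ) : ℂ) := by
  have hvan : ∀ n ∉ weilPrimeIndex a,
      ((Λ n : ℝ) : ℂ) / (Real.sqrt n : ℂ) * (weilConv g (weilReflect g) (Real.log n) +
        weilConv g (weilReflect g) (-Real.log n)) = 0 := by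
    intro n hn
    rw [mem_weilPrimeIndex, not_lt] at hn
    have h0 : 0 ≤ Real.log n := Real.log_natCast_nonneg n
    have h1 : weilConv g (weilReflect g) (Real.log n) = 0 :=
      weilConv_weilReflect_eq_zero_of_le_abs hg hsupp (by rwa [abs_of_nonneg h0])
    have h2 : weilConv g (weilReflect g) (-Real.log n) = 0 :=
      weilConv_weilReflect_eq_zero_of_le_abs hg hsupp (by rwa [abs_neg, abs_of_nonneg h0])
    rw [h1, h2, add_zero, mul_zero]
  unfold weilPrimeTerm
  rw [tsum_eq_sum hvan]
  push_cast
  refine Finset.sum_congr rfl fun n _ ↦ ?_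
  rw [weilConv_weilReflect_add_neg hg]
  push_cast
  ring

/-! ## The archimedean term through increments -/

/-- **Bombieri's archimedean term through increments**: for a test function `g` and `k = g ⋆ g̃`,
`−(log 4π + γ) k(0) − ∫₀^∞ (e^{t/2}(k(t) + k(−t)) − 2k(0)) dt/(2 sinh t)
  = −(log 4π + γ)‖g‖₂² − ∫₀^∞ (e^{t/2}(2‖g‖₂² − D_t(g)) − 2‖g‖₂²) dt/(2 sinh t)`
(`k(0) = ‖g‖₂²`, `k(t) + k(−t) = 2‖g‖₂² − D_t(g)`). [cite: Bombieri2000Weil, Thm 2 (p. 193), archimedean term] -/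
theorem weilArchTermBombieri_weilConv_weilReflect (hg : IsWeilTest g) :
    weilArchTermBombieri (weilConv g (weilReflect g)) =
      ((-((Real.log (4 * π) + Real.eulerMascheroniConstant) * ∫ x : ℝ, ‖g x‖ ^ 2) -
        ∫ t in Ioi (0 : ℝ), (Real.exp (t / 2) * (2 * (∫ x : ℝ, ‖g x‖ ^ 2) - weilIncrement g t) -
          2 * ∫ x : ℝ, ‖g x‖ ^ 2) / (2 * Real.sinh t) : ℝ) : ℂ) := by
  have hpt : ∀ t : ℝ,
      ((Real.exp (t / 2) : ℂ) * (weilConv g (weilReflect g) t + weilConv g (weilReflect g) (-t)) -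
          2 * weilConv g (weilReflect g) 0) / (2 * Real.sinh t : ℂ) =
        (((Real.exp (t / 2) * (2 * (∫ x : ℝ, ‖g x‖ ^ 2) - weilIncrement g t) -
          2 * ∫ x : ℝ, ‖g x‖ ^ 2) / (2 * Real.sinh t) : ℝ) : ℂ) := by
    intro t
    rw [weilConv_weilReflect_add_neg hg, weilConv_weilReflect_apply_zero]
    push_cast
    ring
  rw [weilArchTermBombieri_eq]
  simp_rw [hpt]
  rw [integral_complex_ofReal, weilConv_weilReflect_apply_zero]
  push_cast
  ring

/-! ## Convergence of the archimedean integrals -/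

/-- The killing density `(e^{t/2} − 1)/(2 sinh t)` is non-negative on `(0, ∞)`. [folklore] -/
theorem weilKillingDensity_nonneg {t : ℝ} (ht : 0 < t) :
    0 ≤ (Real.exp (t / 2) - 1) / (2 * Real.sinh t) :=
  div_nonneg (sub_nonneg.2 (Real.one_le_exp (by positivity)))
    (mul_nonneg zero_le_two (Real.sinh_pos_iff.2 ht).le)

/-- The killing density is `O(e^{-t/2})`: `(e^{t/2} − 1)/(2 sinh t) ≤ e^{-t/2}` for `t > 0`
(`e^{-t/2} · 2 sinh t = e^{t/2} − e^{-3t/2} ≥ e^{t/2} − 1`). [folklore] -/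
theorem weilKillingDensity_le {t : ℝ} (ht : 0 < t) :
    (Real.exp (t / 2) - 1) / (2 * Real.sinh t) ≤ Real.exp (-(1 / 2) * t) := by
  have h2s : 0 < 2 * Real.sinh t := mul_pos two_pos (Real.sinh_pos_iff.2 ht)
  rw [div_le_iff₀ h2s]
  have h1 : Real.exp (-(1 / 2) * t) * Real.exp t = Real.exp (t / 2) := by
    rw [← Real.exp_add]; congr 1; ring
  have h2 : Real.exp (-(1 / 2) * t) * Real.exp (-t) = Real.exp (-(3 / 2) * t) := by
    rw [← Real.exp_add]; congr 1; ring
  have h3 : Real.exp (-(3 / 2) * t) ≤ 1 := Real.exp_le_one_iff.2 (by linarith)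
  calc Real.exp (t / 2) - 1 ≤ Real.exp (t / 2) - Real.exp (-(3 / 2) * t) := by linarith
    _ = Real.exp (-(1 / 2) * t) * Real.exp t - Real.exp (-(1 / 2) * t) * Real.exp (-t) := by
        rw [h1, h2]
    _ = Real.exp (-(1 / 2) * t) * (2 * Real.sinh t) := by rw [Real.sinh_eq]; ring

/-- **The killing integral converges**: `t ↦ (e^{t/2} − 1)/(2 sinh t)` is integrable on `(0, ∞)`
(bounded by `e^{-t/2}`; it extends continuously by `1/4` at `0`). [folklore] -/
theorem integrableOn_weilKillingDensity :
    IntegrableOn (fun t : ℝ ↦ (Real.exp (t / 2) - 1) / (2 * Real.sinh t)) (Ioi 0) := by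
  refine Integrable.mono' (exp_neg_integrableOn_Ioi 0 (by norm_num : (0 : ℝ) < 1 / 2)) ?_ ?_
  · exact ((by fun_prop : Continuous fun t : ℝ ↦ Real.exp (t / 2) - 1).measurable.div
      (by fun_prop : Continuous fun t : ℝ ↦ 2 * Real.sinh t).measurable).aestronglyMeasurable
  · refine (ae_restrict_iff' measurableSet_Ioi).2 (Eventually.of_forall fun t (ht : 0 < t) ↦ ?_)
    rw [Real.norm_of_nonneg (weilKillingDensity_nonneg ht)]
    exact weilKillingDensity_le ht

/-- **Bombieri's integrand is integrable** on `(0, ∞)` for every test function `k`: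
`t ↦ (e^{t/2}(k(t) + k(−t)) − 2k(0))/(2 sinh t)` (it is `(e^{t/2} K(t) − K(0))/(2 sinh t)` for the
test function `K = k + k(−·)`, `integrableOn_bombieriMajorant`). [folklore] -/
theorem integrableOn_bombieriIntegrand {k : ℝ → ℂ} (hk : IsWeilTest k) :
    IntegrableOn (fun x : ℝ ↦ ((Real.exp (x / 2) : ℂ) * (k x + k (-x)) - 2 * k 0) /
      (2 * Real.sinh x : ℂ)) (Ioi 0) := by
  have hkc : Continuous k := hk.1.continuous
  refine Integrable.mono' (integrableOn_bombieriMajorant hk.weilSymm) ?_ ?_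
  · refine (Measurable.div ?_ ?_).aestronglyMeasurable
    · exact (by fun_prop :
        Continuous fun x : ℝ ↦ (Real.exp (x / 2) : ℂ) * (k x + k (-x)) - 2 * k 0).measurable
    · exact (by fun_prop : Continuous fun x : ℝ ↦ (2 * Real.sinh x : ℂ)).measurable
  · refine (ae_restrict_iff' measurableSet_Ioi).2 (Eventually.of_forall fun x (hx : 0 < x) ↦ ?_)
    have hsinh : 0 < Real.sinh x := Real.sinh_pos_iff.2 hx
    have hnum : (Real.exp (x / 2) : ℂ) * (k x + k (-x)) - 2 * k 0 =
        (Real.exp (x / 2) : ℂ) * weilSymm k x - weilSymm k 0 := by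
      rw [weilSymm_zero]; rfl
    have hden : ‖(2 * Real.sinh x : ℂ)‖ = 2 * Real.sinh x := by
      rw [← Complex.ofReal_ofNat, ← Complex.ofReal_mul, Complex.norm_real,
        Real.norm_of_nonneg (by positivity)]
    rw [norm_div, hnum, hden]

/-- **Test functions have finite energy**: for a test function `g` the archimedean part of `𝓔_a(g)`
converges absolutely, `t ↦ e^{t/2}/(2 sinh t) · D_t(g)` is integrable on `(0, ∞)` (it equals
`2‖g‖₂² (e^{t/2} − 1)/(2 sinh t)` minus Bombieri's integrand for `k = g ⋆ g̃`, both integrable). [folklore] -/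
theorem integrableOn_weilArchDensity_mul_weilIncrement (hg : IsWeilTest g) :
    IntegrableOn (fun t : ℝ ↦ weilArchDensity t * weilIncrement g t) (Ioi 0) := by
  have hk : IsWeilTest (weilConv g (weilReflect g)) := hg.weilConv hg.weilReflect
  have hB := integrableOn_bombieriIntegrand hk
  -- Bombieri's integrand is the real function `2‖g‖² w₁ − w₂ D`
  have hpt : ∀ t : ℝ,
      ((Real.exp (t / 2) : ℂ) * (weilConv g (weilReflect g) t + weilConv g (weilReflect g) (-t)) -
          2 * weilConv g (weilReflect g) 0) / (2 * Real.sinh t : ℂ) =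
        ((2 * (∫ x : ℝ, ‖g x‖ ^ 2) * ((Real.exp (t / 2) - 1) / (2 * Real.sinh t)) -
          weilArchDensity t * weilIncrement g t : ℝ) : ℂ) := by
    intro t
    rw [weilConv_weilReflect_add_neg hg, weilConv_weilReflect_apply_zero]
    unfold weilArchDensity
    push_cast
    ring
  simp_rw [hpt] at hB
  have hF : Integrable (fun t : ℝ ↦ 2 * (∫ x : ℝ, ‖g x‖ ^ 2) *
      ((Real.exp (t / 2) - 1) / (2 * Real.sinh t)) - weilArchDensity t * weilIncrement g t)
      (volume.restrict (Ioi 0)) := by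
    simpa only [RCLike.re_to_complex, Complex.ofReal_re] using hB.re
  have h := (integrableOn_weilKillingDensity.const_mul (2 * ∫ x : ℝ, ‖g x‖ ^ 2)).sub hF
  refine h.congr (Eventually.of_forall fun t ↦ ?_)
  simp only [Pi.sub_apply]
  ring

/-- **Splitting Bombieri's integral**: for a test function `g`,
`∫₀^∞ (e^{t/2}(2‖g‖₂² − D_t(g)) − 2‖g‖₂²) dt/(2 sinh t)
  = 2‖g‖₂² ∫₀^∞ (e^{t/2} − 1) dt/(2 sinh t) − ∫₀^∞ e^{t/2}/(2 sinh t) D_t(g) dt`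
(both pieces converge). [folklore] -/
theorem integral_bombieriIntegrand_eq_sub (hg : IsWeilTest g) :
    ∫ t in Ioi (0 : ℝ), (Real.exp (t / 2) * (2 * (∫ x : ℝ, ‖g x‖ ^ 2) - weilIncrement g t) -
        2 * ∫ x : ℝ, ‖g x‖ ^ 2) / (2 * Real.sinh t) =
      2 * (∫ x : ℝ, ‖g x‖ ^ 2) * (∫ t in Ioi (0 : ℝ), (Real.exp (t / 2) - 1) / (2 * Real.sinh t)) -
        ∫ t in Ioi (0 : ℝ), weilArchDensity t * weilIncrement g t := by
  have hpt : ∀ t : ℝ, (Real.exp (t / 2) * (2 * (∫ x : ℝ, ‖g x‖ ^ 2) - weilIncrement g t) -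
      2 * ∫ x : ℝ, ‖g x‖ ^ 2) / (2 * Real.sinh t) =
        2 * (∫ x : ℝ, ‖g x‖ ^ 2) * ((Real.exp (t / 2) - 1) / (2 * Real.sinh t)) -
          weilArchDensity t * weilIncrement g t := by
    intro t
    unfold weilArchDensity
    ring
  simp_rw [hpt]
  rw [integral_sub (integrableOn_weilKillingDensity.const_mul _)
    (integrableOn_weilArchDensity_mul_weilIncrement hg), integral_const_mul]

/-! ## The Markov decomposition -/

/-- **The Markov decomposition of Weil's quadratic functional** (Bombieri's explicit formula,
Thm 2, for `k = g ⋆ g̃`, with `k(t) + k(−t) = 2‖g‖₂² − D_t(g)` inserted in the prime term and in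
the archimedean term `weilArchTermBombieri`): for a test function `g` with `tsupport g ⊆ [-a, a]`,

`Re Q(g) − P(g) = weilMarkovQuadratic g = 𝓔_a(g) − M_a ‖g‖₂²`,

`𝓔_a = weilDirichletEnergy a` the pure-jump Dirichlet form of the window and
`M_a = weilMarkovConstant a`. [cite: Bombieri2000Weil, Thm 2 (p. 193)] -/
theorem weilMarkovQuadratic_eq_weilDirichletEnergy_sub (hg : IsWeilTest g) {a : ℝ}
    (hsupp : tsupport g ⊆ Icc (-a) a) :
    weilMarkovQuadratic g =
      weilDirichletEnergy a g - weilMarkovConstant a * ∫ x : ℝ, ‖g x‖ ^ 2 := by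
  have hk : IsWeilTest (weilConv g (weilReflect g)) := hg.weilConv hg.weilReflect
  have hsum : ∑ n ∈ weilPrimeIndex a, (Λ n : ℝ) / Real.sqrt n *
      (2 * (∫ x : ℝ, ‖g x‖ ^ 2) - weilIncrement g (Real.log n)) =
        2 * (∫ x : ℝ, ‖g x‖ ^ 2) * (∑ n ∈ weilPrimeIndex a, (Λ n : ℝ) / Real.sqrt n) -
          ∑ n ∈ weilPrimeIndex a, (Λ n : ℝ) / Real.sqrt n * weilIncrement g (Real.log n) := by
    rw [Finset.mul_sum, ← Finset.sum_sub_distrib]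
    exact Finset.sum_congr rfl fun n _ ↦ by ring
  rw [weilMarkovQuadratic_eq_re hg, ← weilArchTermBombieri_eq_weilArchTerm_holds hk,
    weilPrimeTerm_weilConv_weilReflect hg hsupp, weilArchTermBombieri_weilConv_weilReflect hg,
    Complex.ofReal_re, Complex.ofReal_re, integral_bombieriIntegrand_eq_sub hg, hsum]
  unfold weilDirichletEnergy weilMarkovConstant
  ring

/-- The same decomposition for `Re Q(g)` itself: `Re Q(g) = P(g) + 𝓔_a(g) − M_a ‖g‖₂²`. [cite: Bombieri2000Weil, Thm 2 (p. 193)] -/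
theorem weilQuadratic_re_eq_weilPoleForm_add_weilDirichletEnergy_sub (hg : IsWeilTest g) {a : ℝ}
    (hsupp : tsupport g ⊆ Icc (-a) a) :
    (weilQuadratic g).re =
      weilPoleForm g + weilDirichletEnergy a g - weilMarkovConstant a * ∫ x : ℝ, ‖g x‖ ^ 2 := by
  rw [weilQuadratic_re_eq_weilPoleForm_add, weilMarkovQuadratic_eq_weilDirichletEnergy_sub hg hsupp]
  ring

end Literature.NumberTheory.LFunctions

end
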